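import Summits.AtomisticToContinuum.HydrodynamicLimit.Theses.OneFlightGossipEngine
import Literature.MathematicalPhysics.KineticTheory.HardSphereEulerProofs
import Literature.MathematicalPhysics.KineticTheory.VelocityBlindPlacement
import Summits.AtomisticToContinuum.HydrodynamicLimit.Theorems.OneFlightGossipEngineKineticCurrentsWindowLDUniformStaticHydroDomination
import Summits.AtomisticToContinuum.HydrodynamicLimit.Theorems.OneFlightGossipEngineKineticCurrentsWindowLDUniformOneBodyLedger
import Summits.AtomisticToContinuum.HydrodynamicLimit.Theorems.OneFlightGossipEngineKineticCurrentsWindowLDUniformMarginalEntropyLedger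
import Summits.AtomisticToContinuum.HydrodynamicLimit.Theorems.OneFlightGossipEngineKineticCurrentsWindowLDUniformEntropyQuasiInvariance
import Summits.AtomisticToContinuum.HydrodynamicLimit.Theorems.OneFlightGossipEngineKineticCurrentsWindowLDUniformLocalGibbsLedgerAssembly
import Summits.AtomisticToContinuum.HydrodynamicLimit.Theorems.OneFlightGossipEngineKineticCurrentsWindowLDUniformWindowRenyiOfTransport

/-!
# Skeleton — crux `KineticCurrentsWindowLDUniform` (stmt-AtomisticToContinuum-14662), line `local-gibbs-entropy-ledger` (lead chain c2: prover-line-…-14662-c2-0)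

STATUS (lead chain c2, cycle 1, 2026-08-16T20:00Z). LANDED: S1 `stub_staticHydroDomination` p118180 (+Prelim p116868),
S2 `stub_oneBodyLedger_of_static` p120807 (+PrelimA p119375, PrelimB p120000), S3 `stub_marginalEntropyLedger` p121942
(+Prelim p121257), S5 `stub_entropyQuasiInvariance_of_renyi` p121248, S7' `stub_localGibbsLedgerAssemblyByName` p122768
(+Prelim p121724; the named-form assembly replacing the planner's S7), and the REDUCTION of the shared research stub S4
`stub_windowRenyi` to kinetic-window transport tightness, `stub_windowRenyi_of_transport` p123401 (+Prelim p122426) — all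
in namespace `Summit.AtomisticToContinuum.HydrodynamicLimit.Theorems.KineticCurrentsWindowLDUniformLocalGibbs`, imported
below. RESHAPED: S4 := `stub_windowRenyi_of_transport stub_windowTransport` with the NEW registered stub S4''
`stub_windowTransport` (exponential tightness of the tested kinetic-energy / momentum fields over the kinetic window under
the local Gibbs law — the S4 probe showed collision-COUNT formulations are false at LD scale (compressed droplets) while net
transport of conserved fields is the honest content; analysis `windowRenyi-analysis.md` on the item). OPEN (exactly the two
sorries of this file): S4'' `stub_windowTransport` and S6 `stub_integratedKineticEntropyBound` (C⁺, lead) — both dynamical,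
research-level; `KineticCurrentsWindowLDUniform_of` = crux ⟸ S4'' ∧ S6, kernel-checked.

Crux-plan of the triaged idea card `Ideas/local-gibbs-entropy-ledger.md` (ideator 2; triage r1-1 / r1-2:
pass, with sharpenings that are all acted on below). Line card: `Lines/local-gibbs-entropy-ledger.md`.

THE LINE. Dualise the window pressure `Λ_N(β) = log ∫ e^{βS} dλ^N` (Gibbs variational identity for the
explicit tilted family `Q_β = e^{βS}λ^N / Z`, no argmax): `Λ_N = β E_{Q_β} S − KL(Q_β ‖ λ^N)`. The mean
`E_{Q_β} S` is `(N+1)` times the window average of `∫ F d f̄_r`, `f̄_r` the AVERAGED one-body marginal of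
`Q_β ∘ Φ_r⁻¹`. Pay `∫ F d f̄_r` with the ONE-BODY ENTROPY LEDGER (static, fibrewise in `x`): Gaussian
Pythagoras splits the fibre entropy `KL(f̄_r(·|x) ‖ M_x)` into a kinetic part (against the moment-matched
Maxwellian) and a hydrodynamic part `E_x(u,θ) = KL(M_{1,u,θ} ‖ M_x)`; the hydrodynamic pairing is dominated
LINEARLY by `E_x` with NO additive constant (`stub_staticHydroDomination`: the three orthogonality
clauses are exactly second-order vanishing of `(u,θ) ↦ ∫ F M_{1,u,θ}` at `(u₀(x), θ₀(x))`), the kinetic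
pairing by `L·√(kinetic fibre entropy)` (weighted Csiszár–Kullback–Pinsker below entropy `1`, second
moments above; hot fibres re-routed to the linear term). The fibre entropy of `f̄_r` is at most
`KL(Q_β∘Φ_r⁻¹ ‖ λ^N)/(N+1)` (`stub_marginalEntropyLedger`: positions dropped, heterogeneous-product
subadditivity given the positions, convexity twice), and `KL(Q_β∘Φ_r⁻¹ ‖ λ^N) ≤ c·KL(Q_β ‖ λ^N) + δ(N+1)`
over a kinetic window (`stub_entropyQuasiInvariance_of_renyi` from the SHARED Rényi quasi-invariance stub
`stub_windowRenyi`, verbatim the one registered by line `Sketch`). What is left is the line's dynamical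
residual `C⁺ = stub_integratedKineticEntropyBound`: the window-averaged, density-weighted root kinetic fibre
entropy of the one-body marginals of ONE tilted family is `≤ ε'·(KL(Q_β‖λ^N)/(N+1) + 1)` for large `τ`
(an integrated H-theorem at large-deviation cost scale). The assembly (`stub_localGibbsLedgerAssembly`) is the
Gibbs identity + marginal Fubini + the arithmetic
`Λ_N/(N+1) ≤ h(|β|Kc + |β|Lε' − 1) + |β|Kδ' + |β|Lε' ≤ ε` for `|β| ≤ β₀ := min(β₁, 1/(4Kc), 1/(4Cθ_max+1))`.

Composition: `KineticCurrentsWindowLDUniform_of` concludes the crux BY NAME from the seven stubs; the only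
theorem whose conclusion is the crux constant is `_of` (the assembly stub concludes the crux body AT a given
`η₀`, supplied by `C⁺`).

Disproof.lean (cdisprove cycle 1) honoured: §1 `not_…AllN` (`N₀` load-bearing) — collisions enter only
through `C⁺`, which keeps `∃ N₀` and is false for one free sphere (`H_kin` frozen); §3 `not_…AllBeta` /
`tilt_window_lower_bound` (`β₀` static) — `β₀ = min(β₁, 1/(4Kc), …)` is fixed before `ε, τ`, never grows
with `τ`; on the pure-stress drifted-Gibbs witnesses `K = 2θ₀λ_max(A_sym)` is attained (kit j014234: 0.997
vs 1), the factor `c = p/(p-1) ≥ θ_max/θ_min` of the quasi-invariance is carried (triage r1-2: sharpness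
is NOT claimed); §4 `not_…WithoutOrthMom` (`⊥ v_j` load-bearing) — used in `stub_staticHydroDomination`
(first-order vanishing in `u`); §2 `kcw_orth_energy_redundant` — consistent (the static stubs are stated
for general continuous quadratic-growth `F`, where `⊥ ‖v‖²` is genuinely needed). Landed negatives of this
crux (`Theorems/KineticCurrentsWindowLDUniform/Negative/{OrthRedundant, WindowFubini}`; not yet built on the
farm, hence not imported) checked by hand: no stub is an instance of a refuted shape (no `∀ N`, no `∀ β`,
no dropped orthogonality, no cubic exponential moment — cf. stmt-14607's witness).
-/

noncomputable section

open MeasureTheory Set Filter InformationTheory ProbabilityTheory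
open scoped ENNReal Topology

namespace Summit.AtomisticToContinuum.HydrodynamicLimit.Cruxes.KineticCurrentsWindowLDUniform.LocalGibbsEntropyLedger

open Literature.Analysis.FluidPDE (HardSphereFlow Config localMaxwellian canonicalDensity liouville
  energyObservable momentumObservable)
open Literature.MathematicalPhysics.KineticTheory (T3 V3 hsDiameter localGibbsLaw localGibbsMeasure
  localGibbsProfile gaussMeasure)
open Summit.AtomisticToContinuum.HydrodynamicLimit.Theses.OneFlightGossipEngine
  (KineticCurrentsWindowLDUniform)
open Literature.MathematicalPhysics.KineticTheory.VelocityBlindPlacement (Flow)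

/-! ## Stubs — landed ones are derived from the tree by name; open ones carry `sorry` -/

/-- S1 — STATIC HYDRODYNAMIC DOMINATION, UNIFORM ON `𝕋³` (card: `StaticHydroDomination`; static, M).
For continuous `θ₀ > 0`, `u₀` on `𝕋³` and a continuous `F` on `𝕋³ × ℝ³` of quadratic growth, orthogonal at
every `x` to `1, v_j, ‖v‖²` under `M_x = M_{1,u₀(x),θ₀(x)}`, the Maxwellian average
`Φ_F(x;u,θ) = ∫ F(x,v) M_{1,u,θ}(v) dv` is dominated, uniformly in `x`, by the Gaussian relative entropy
`E_x(u,θ) = KL(N(u,θI) ‖ N(u₀(x),θ₀(x)I)) = ‖u-u₀(x)‖²/(2θ₀(x)) + (3/2)(θ/θ₀(x) - 1 - log(θ/θ₀(x)))`.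
(`Φ_F(x;·)` is smooth in `(u, θ > 0)`, vanishes to second order at `(u₀(x),θ₀(x))` exactly by the three
clauses, is `O(1 + ‖u‖² + θ)`; `E_x` is uniformly convex at its zero, `→ ∞` as `θ → 0`; compactness of
`𝕋³` and joint continuity make `K` uniform. Sharp on Disproof §3's witnesses: `K = 2θ₀λ_max(A_sym)` for
`F = A:(w ⊗ w)`.) -/
theorem stub_staticHydroDomination :
    ∀ (θ₀ : T3 → ℝ) (u₀ : T3 → V3), Continuous θ₀ → Continuous u₀ → (∀ x, 0 < θ₀ x) →
      ∀ (F : T3 × V3 → ℝ), Continuous F → ∀ C : ℝ, (∀ y, |F y| ≤ C * (1 + ‖y.2‖ ^ 2)) →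
      (∀ x, ∫ v, F (x, v) * localMaxwellian 1 (θ₀ x) (u₀ x) v = 0) →
      (∀ x (j : Fin 3), ∫ v, F (x, v) * v j * localMaxwellian 1 (θ₀ x) (u₀ x) v = 0) →
      (∀ x, ∫ v, F (x, v) * ‖v‖ ^ 2 * localMaxwellian 1 (θ₀ x) (u₀ x) v = 0) →
      ∃ K : ℝ, 0 ≤ K ∧ ∀ (x : T3) (u : V3) (θ : ℝ), 0 < θ →
        |∫ v, F (x, v) * localMaxwellian 1 θ u v| ≤
          K * (‖u - u₀ x‖ ^ 2 / (2 * θ₀ x) + 3 / 2 * (θ / θ₀ x - 1 - Real.log (θ / θ₀ x))) :=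
  Summit.AtomisticToContinuum.HydrodynamicLimit.Theorems.KineticCurrentsWindowLDUniformLocalGibbs.stub_staticHydroDomination

/-- S2 — THE ONE-BODY ENTROPY LEDGER FROM STATIC DOMINATION (static, L). Given S1, for the same data there
are `K, L > 0` such that for EVERY probability law `f` on `𝕋³ × ℝ³` (fibres `f(·|x) = f.condKernel x`,
density marginal `f.fst`):
`|∫ F df| ≤ K · ∫ KL(f(·|x) ‖ N(u₀(x),θ₀(x)I)) f.fst(dx) + L · ∫ (inf_{u,θ>0} KL(f(·|x) ‖ N(u,θI)))^{1/2} f.fst(dx)`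
(in `ℝ≥0∞`; trivial where the fibre entropy is infinite or `F ∉ L¹(f)`). Proof content: disintegration
`f = f.fst ⊗ f.condKernel`; per fibre, Gaussian Pythagoras `KL(μ‖M_x) = KL(μ‖M[μ]) + E_x(m_μ,e_μ)` with
`M[μ]` the moment-matched Maxwellian (the infimum is attained there); hydrodynamic pairing `∫F dM[μ]` by S1;
kinetic pairing `|∫F d(μ - M[μ])|` by the weighted Csiszár–Kullback–Pinsker inequality of Bolley–Villani
(Gaussian exponential moments of `(1+‖v‖²)` under `M[μ]`) when `KL(μ‖M[μ]) ≤ 1` and by second moments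
`2C(1 + 3e_μ + ‖m_μ‖²)` otherwise, on cold fibres `e_μ + ‖m_μ‖² ≤ Θ`; hot fibres are paid linearly,
`C(1 + 3e + ‖m‖²) ≤ K_hot · E_x(m,e)` with `K_hot = O(C θ_max)` once `Θ = Θ(C, θ₀, u₀)` is large
(`E_x(m,e) ≥ (e + ‖m‖²)/(4θ_max) − ‖u₀‖²/(2θ₀) − 3/2`, from `s − 1 − log s ≥ s/2 − 1`). -/
theorem stub_oneBodyLedger_of_static :
    (∀ (θ₀ : T3 → ℝ) (u₀ : T3 → V3), Continuous θ₀ → Continuous u₀ → (∀ x, 0 < θ₀ x) →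
      ∀ (F : T3 × V3 → ℝ), Continuous F → ∀ C : ℝ, (∀ y, |F y| ≤ C * (1 + ‖y.2‖ ^ 2)) →
      (∀ x, ∫ v, F (x, v) * localMaxwellian 1 (θ₀ x) (u₀ x) v = 0) →
      (∀ x (j : Fin 3), ∫ v, F (x, v) * v j * localMaxwellian 1 (θ₀ x) (u₀ x) v = 0) →
      (∀ x, ∫ v, F (x, v) * ‖v‖ ^ 2 * localMaxwellian 1 (θ₀ x) (u₀ x) v = 0) →
      ∃ K : ℝ, 0 ≤ K ∧ ∀ (x : T3) (u : V3) (θ : ℝ), 0 < θ →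
        |∫ v, F (x, v) * localMaxwellian 1 θ u v| ≤
          K * (‖u - u₀ x‖ ^ 2 / (2 * θ₀ x) + 3 / 2 * (θ / θ₀ x - 1 - Real.log (θ / θ₀ x)))) →
    ∀ (θ₀ : T3 → ℝ) (u₀ : T3 → V3), Continuous θ₀ → Continuous u₀ → (∀ x, 0 < θ₀ x) →
      ∀ (F : T3 × V3 → ℝ), Continuous F → ∀ C : ℝ, (∀ y, |F y| ≤ C * (1 + ‖y.2‖ ^ 2)) →
      (∀ x, ∫ v, F (x, v) * localMaxwellian 1 (θ₀ x) (u₀ x) v = 0) →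
      (∀ x (j : Fin 3), ∫ v, F (x, v) * v j * localMaxwellian 1 (θ₀ x) (u₀ x) v = 0) →
      (∀ x, ∫ v, F (x, v) * ‖v‖ ^ 2 * localMaxwellian 1 (θ₀ x) (u₀ x) v = 0) →
      ∃ K : ℝ, 0 < K ∧ ∃ L : ℝ, 0 < L ∧ ∀ (f : Measure (T3 × V3)) [IsProbabilityMeasure f],
        ENNReal.ofReal |∫ y, F y ∂f| ≤
          ENNReal.ofReal K * ∫⁻ x, klDiv (f.condKernel x) (gaussMeasure (u₀ x) (θ₀ x)) ∂f.fst +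
          ENNReal.ofReal L *
            ∫⁻ x, (⨅ (u : V3) (θ : ℝ) (_ : 0 < θ), klDiv (f.condKernel x) (gaussMeasure u θ)) ^ (1 / 2 : ℝ)
              ∂f.fst :=
  Summit.AtomisticToContinuum.HydrodynamicLimit.Theorems.KineticCurrentsWindowLDUniformLocalGibbs.stub_oneBodyLedger_of_static

/-- S3 — THE MARGINAL ENTROPY LEDGER (static measure theory, M/L). For the local Gibbs measure `λ^N`
(`σ ≤ 1/2`: a probability measure whose velocity fibre GIVEN THE POSITIONS is the heterogeneous product
`⊗ᵢ N(u₀(xᵢ), θ₀(xᵢ)I)`, tree `lintegral_localGibbsMeasure` / `velMeasure`) and ANY probability law `P` of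
`N+1` spheres, the fibre entropy of the averaged one-body marginal `f̄ = (N+1)⁻¹ Σᵢ P∘πᵢ⁻¹` against the
local Maxwellian field is at most `KL(P ‖ λ^N)/(N+1)`: chain rule (drop the position part, `≥ 0`),
subadditivity of `KL` over a heterogeneous PRODUCT reference given the positions (card:
`HeteroProductEntropySubadditivity`), convexity of `KL` in the law for the mixture over the other positions,
joint convexity for the average over `i`. No dynamics, no `σ`-expansion. -/
theorem stub_marginalEntropyLedger :
    ∀ (a θ₀ : T3 → ℝ) (u₀ : T3 → V3), Continuous a → Continuous θ₀ → Continuous u₀ →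
      (∀ x, 0 < a x) → (∀ x, 0 < θ₀ x) → ∀ σ : ℝ, 0 < σ → σ ≤ 1 / 2 → ∀ N : ℕ,
      ∀ (P : Measure (Config (N + 1) (Fin 3) T3)) [IsProbabilityMeasure P],
      ∀ (fbar : Measure (T3 × V3)) [IsProbabilityMeasure fbar],
        fbar = ((N : ℝ≥0∞) + 1)⁻¹ • ∑ i : Fin (N + 1), P.map (fun z => z i) →
        ((N : ℝ≥0∞) + 1) * ∫⁻ x, klDiv (fbar.condKernel x) (gaussMeasure (u₀ x) (θ₀ x)) ∂fbar.fst ≤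
          klDiv P (localGibbsMeasure σ a u₀ θ₀ N) :=
  fun a θ₀ u₀ ha hθ hu ha0 hθ0 σ hσ hσ2 N P _ fbar _ hf =>
    Summit.AtomisticToContinuum.HydrodynamicLimit.Theorems.KineticCurrentsWindowLDUniformLocalGibbs.stub_marginalEntropyLedger a θ₀ u₀ ha hθ hu ha0 hθ0 σ hσ hσ2 N P fbar hf

/-- S4'' — KINETIC-WINDOW TRANSPORT TIGHTNESS (NEW registered stub, chain c2 reshape of the shared research stub S4;
research-level). Under every local Gibbs law of hard spheres at fixed reduced density `σ ≤ 1/2` (continuous positive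
profiles), the kinetic-energy field tested against any continuous `ϑ` and the momentum field tested against any
continuous `J` are exponentially tight over the kinetic window: `∃ s > 0 ∀ τ ∀ κ > 0 ∀ Φ ∃ N₀ ∀ N ≥ N₀
∀ r ∈ [0, τ(N+1)^{-1/3}]: ∫ exp(s(|E_ϑ(Φ_r z) − E_ϑ(z)| + |M_J(Φ_r z) − M_J(z)|)) dλ^N ≤ e^{κ(N+1)}`
(`E_ϑ = energyObservable ϑ = Σᵢ ϑ(xᵢ)‖vᵢ‖²/2`, `M_J = momentumObservable J = Σᵢ ⟪J(xᵢ), vᵢ⟫`). Free flight: fine by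
uniform continuity and Gaussian tails; the open content is the NET transport of conserved fields by collision chains
at large-deviation cost `o(N)` (Newton-cradle necklaces: `o(N)` transport or super-extensive cost — S4 probe). It is
verbatim the hypothesis of the landed reduction `stub_windowRenyi_of_transport` (p123401). -/
theorem stub_windowTransport :
    ∀ (a θ₀ : T3 → ℝ) (u₀ : T3 → V3), Continuous a → Continuous θ₀ → Continuous u₀ →
      (∀ x, 0 < a x) → (∀ x, 0 < θ₀ x) → ∀ σ : ℝ, 0 < σ → σ ≤ 1 / 2 →
      ∀ (ϑ : T3 → ℝ) (J : T3 → V3), Continuous ϑ → Continuous J →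
      ∃ s : ℝ, 0 < s ∧ ∀ τ : ℝ, 0 < τ → ∀ κ : ℝ, 0 < κ →
      ∀ Φ : (N : ℕ) →
        HardSphereFlow (Literature.Analysis.FluidPDE.Torus.geometry (Fin 3)) (hsDiameter σ N) (N + 1),
      ∃ N₀ : ℕ, ∀ N : ℕ, N₀ ≤ N → ∀ r ∈ Set.Icc (0 : ℝ) (τ * ((N : ℝ) + 1) ^ (-(1 / 3 : ℝ))),
        ∫⁻ z, ENNReal.ofReal (Real.exp (s *
            (|energyObservable ϑ ((Φ N).flow r z) - energyObservable ϑ z| +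
              |momentumObservable J ((Φ N).flow r z) - momentumObservable J z|)))
          ∂(localGibbsLaw σ a u₀ θ₀ N (Φ N)) ≤
        ENNReal.ofReal (Real.exp (κ * ((N : ℝ) + 1))) := by
  sorry

/-- S4 — RÉNYI QUASI-INVARIANCE OF THE LOCAL GIBBS LAW OVER A KINETIC WINDOW (SHARED stub, verbatim the one of lines
`Sketch`/`sigma-uniform-…`; chain c2: DERIVED from S4'' `stub_windowTransport` by the landed reduction
`stub_windowRenyi_of_transport` p123401; isothermal case landed independently as `stub_windowRenyi_isothermal` p96904). For continuous positive profiles and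
`σ ≤ 1/2` there is an order `p > 1` such that for every window parameter `τ`, every `δ > 0`, every flow family
and all large `N`, uniformly in `r ∈ [0, τ(N+1)^{-1/3}]`: `∫ (ψ∘Φ_{-r})^p ψ^{1-p} dL ≤ e^{pδ(N+1)}` (`ψ` the
canonical local Gibbs density, `L` the Liouville measure). This line consumes it only through S5. -/
theorem stub_windowRenyi :
    ∀ (a θ₀ : T3 → ℝ) (u₀ : T3 → V3), Continuous a → Continuous θ₀ → Continuous u₀ →
    (∀ x, 0 < a x) → (∀ x, 0 < θ₀ x) → ∀ σ : ℝ, 0 < σ → σ ≤ 1 / 2 →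
    ∃ p : ℝ, 1 < p ∧ ∀ τ : ℝ, 0 < τ → ∀ δ : ℝ, 0 < δ →
    ∀ Φ : (N : ℕ) →
      HardSphereFlow (Literature.Analysis.FluidPDE.Torus.geometry (Fin 3)) (hsDiameter σ N) (N + 1),
    ∃ N₀ : ℕ, ∀ N : ℕ, N₀ ≤ N → ∀ r ∈ Set.Icc (0 : ℝ) (τ * ((N : ℝ) + 1) ^ (-(1 / 3 : ℝ))),
      ∫⁻ z, ENNReal.ofReal (canonicalDensity (Literature.Analysis.FluidPDE.Torus.geometry (Fin 3))
            (hsDiameter σ N) (N + 1) (localGibbsProfile a u₀ θ₀) ((Φ N).flow (-r) z)) ^ p *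
          ENNReal.ofReal (canonicalDensity (Literature.Analysis.FluidPDE.Torus.geometry (Fin 3))
            (hsDiameter σ N) (N + 1) (localGibbsProfile a u₀ θ₀) z) ^ (1 - p)
        ∂(liouville (Literature.Analysis.FluidPDE.Torus.geometry (Fin 3)) (N + 1) (hsDiameter σ N)) ≤
      ENNReal.ofReal (Real.exp (p * (δ * ((N : ℝ) + 1)))) :=
  Summit.AtomisticToContinuum.HydrodynamicLimit.Theorems.KineticCurrentsWindowLDUniformLocalGibbs.stub_windowRenyi_of_transport stub_windowTransport

/-- S5 — ENTROPY-LEVEL QUASI-INVARIANCE FROM RÉNYI (M, provable over the tree: `klDiv_lawAt_eq`, Liouville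
transport of the density, the easy half of Donsker–Varadhan). Given S4 (order `p`), with `c = p/(p-1)`: for
every window parameter `τ`, `δ > 0`, flow family, all large `N`, all `r ∈ [0, τ(N+1)^{-1/3}]` and EVERY
probability law `P` of the initial data, `KL(P∘Φ_r⁻¹ ‖ λ^N) ≤ c · KL(P ‖ λ^N) + δ(N+1)`:
`KL(P∘Φ_r⁻¹‖λ) = KL(P‖(Φ_{-r})_*λ) = KL(P‖λ) + E_P[log(ψ/ψ∘Φ_r)]` and the entropy inequality
`E_P[(p-1) log(ψ/ψ∘Φ_r)] ≤ KL(P‖λ) + log ∫ ψ^p (ψ∘Φ_r)^{1-p} dL`, the last integral being S4's after the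
Liouville-preserving change of variables `z ↦ Φ_{-r} z`. This is the form the ledger consumes (triage r1-2:
"replace `E_{q*}[D_r] = o(N)` by `H(q*_r|λ) ≤ (1+1/γ)H(q*|λ) + D_{1+γ}(λ_r‖λ)`"). -/
theorem stub_entropyQuasiInvariance_of_renyi :
    (∀ (a θ₀ : T3 → ℝ) (u₀ : T3 → V3), Continuous a → Continuous θ₀ → Continuous u₀ →
      (∀ x, 0 < a x) → (∀ x, 0 < θ₀ x) → ∀ σ : ℝ, 0 < σ → σ ≤ 1 / 2 →
      ∃ p : ℝ, 1 < p ∧ ∀ τ : ℝ, 0 < τ → ∀ δ : ℝ, 0 < δ →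
      ∀ Φ : (N : ℕ) →
        HardSphereFlow (Literature.Analysis.FluidPDE.Torus.geometry (Fin 3)) (hsDiameter σ N) (N + 1),
      ∃ N₀ : ℕ, ∀ N : ℕ, N₀ ≤ N → ∀ r ∈ Set.Icc (0 : ℝ) (τ * ((N : ℝ) + 1) ^ (-(1 / 3 : ℝ))),
        ∫⁻ z, ENNReal.ofReal (canonicalDensity (Literature.Analysis.FluidPDE.Torus.geometry (Fin 3))
              (hsDiameter σ N) (N + 1) (localGibbsProfile a u₀ θ₀) ((Φ N).flow (-r) z)) ^ p *
            ENNReal.ofReal (canonicalDensity (Literature.Analysis.FluidPDE.Torus.geometry (Fin 3))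
              (hsDiameter σ N) (N + 1) (localGibbsProfile a u₀ θ₀) z) ^ (1 - p)
          ∂(liouville (Literature.Analysis.FluidPDE.Torus.geometry (Fin 3)) (N + 1) (hsDiameter σ N)) ≤
        ENNReal.ofReal (Real.exp (p * (δ * ((N : ℝ) + 1))))) →
    ∀ (a θ₀ : T3 → ℝ) (u₀ : T3 → V3), Continuous a → Continuous θ₀ → Continuous u₀ →
      (∀ x, 0 < a x) → (∀ x, 0 < θ₀ x) → ∀ σ : ℝ, 0 < σ → σ ≤ 1 / 2 →
      ∃ c : ℝ, 1 ≤ c ∧ ∀ τ : ℝ, 0 < τ → ∀ δ : ℝ, 0 < δ →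
      ∀ Φ : (N : ℕ) →
        HardSphereFlow (Literature.Analysis.FluidPDE.Torus.geometry (Fin 3)) (hsDiameter σ N) (N + 1),
      ∃ N₀ : ℕ, ∀ N : ℕ, N₀ ≤ N → ∀ r ∈ Set.Icc (0 : ℝ) (τ * ((N : ℝ) + 1) ^ (-(1 / 3 : ℝ))),
      ∀ (P : Measure (Config (N + 1) (Fin 3) T3)) [IsProbabilityMeasure P],
        klDiv (P.map ((Φ N).flow r)) (localGibbsLaw σ a u₀ θ₀ N (Φ N)) ≤
          ENNReal.ofReal c * klDiv P (localGibbsLaw σ a u₀ θ₀ N (Φ N)) +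
            ENNReal.ofReal (δ * ((N : ℝ) + 1)) :=
  Summit.AtomisticToContinuum.HydrodynamicLimit.Theorems.KineticCurrentsWindowLDUniformLocalGibbs.stub_entropyQuasiInvariance_of_renyi

/-- S6 — THE LINE'S DYNAMICAL RESIDUAL `C⁺`: INTEGRATED KINETIC-ENTROPY BOUND FOR ONE TILTED FAMILY
(research-level; the hardest stub; collisions enter the line HERE AND ONLY HERE — false for one free sphere,
Disproof §1). Frame of the crux with `η₀ ≤ 1/8` (so `σ ≤ 1/2`); for an admissible `F` there is `β₁ > 0`
such that for `|β| ≤ β₁` and every `ε' > 0`, for some `τ` and all large `N`: with `w = τ(N+1)^{-1/3}`,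
`S = Σᵢ w⁻¹∫₀ʷ F((Φ_r z)ᵢ) dr`, the EXPLICIT tilted law `Q = e^{βS}λ^N/Z` (Mathlib `Measure.tilted`, triage
r1-1: no argmax) and the AVERAGED one-body marginals `f̄_r = (N+1)⁻¹ Σᵢ Q∘((Φ_r ·)ᵢ)⁻¹` (triage r1-1), the
window average of the density-weighted ROOT kinetic fibre entropy
`𝒦(f̄_r) = ∫ (inf_{u,θ>0} KL(f̄_r(·|x) ‖ N(u,θI)))^{1/2} f̄_r.fst(dx)` is at most `ε'·(KL(Q‖λ^N)/(N+1) + 1)`.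
WHY THIS FORM (planner's sharpening, see the line card): the fibrewise square root (not `√` of the total
kinetic entropy) is what the ledger S2 produces AND what survives the cheap-coldness attacks (ultra-cold
two-beam voids: `𝒦 ≈ φ√G` against cost `≥ φG`, `φ ≲ ω/τ'`; homogeneous cold two-beams: `𝒦 ≤ √Γ` against
cost `Γ ≥ 3 log τ'`), while echo states and hot-tail energy cascades give `O(√h/τ')`; the whole
hydrodynamic / local-equilibrium sector (Disproof §3's witness zoo, cold comoving droplets, temperature and
density structures) has `𝒦 = 0` and is paid statically by S1–S2. Natural engine: the exact one-body entropy
production identity along the flow (record sum), its chaotic part coercive by the PROVED linearised gap,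
plus a one-sided incoming-chaos bound — the kinetic-chaos content of the crux in entropy clothing. -/
theorem stub_integratedKineticEntropyBound :
    ∃ η₀ : ℝ, 0 < η₀ ∧ η₀ ≤ 1 / 8 ∧
    ∀ (a θ₀ : T3 → ℝ) (u₀ : T3 → V3), Continuous a → Continuous θ₀ → Continuous u₀ →
      (∀ x, 0 < a x) → (∀ x, 0 < θ₀ x) → ∀ σ : ℝ, 0 < σ → σ ^ 3 * (⨆ x, a x) ≤ η₀ * ∫ x, a x →
      ∀ Φ : (N : ℕ) →
        HardSphereFlow (Literature.Analysis.FluidPDE.Torus.geometry (Fin 3)) (hsDiameter σ N) (N + 1),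
      ∀ (A : T3 → Fin 3 → Fin 3 → ℝ) (b : T3 → V3) (G : T3 × ℝ → ℝ),
      Continuous A → Continuous b → Continuous G →
      ∀ (F : T3 × V3 → ℝ), (∀ y, F y =
        (∑ j : Fin 3, ∑ k : Fin 3, A y.1 j k * ((y.2 - u₀ y.1) j * (y.2 - u₀ y.1) k)) +
          (∑ j : Fin 3, b y.1 j * (y.2 - u₀ y.1) j) * G (y.1, ‖y.2 - u₀ y.1‖ ^ 2)) →
      ∀ C : ℝ, (∀ y, |F y| ≤ C * (1 + ‖y.2‖ ^ 2)) →
      (∀ x, ∫ v, F (x, v) * localMaxwellian 1 (θ₀ x) (u₀ x) v = 0) →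
      (∀ x (j : Fin 3), ∫ v, F (x, v) * v j * localMaxwellian 1 (θ₀ x) (u₀ x) v = 0) →
      (∀ x, ∫ v, F (x, v) * ‖v‖ ^ 2 * localMaxwellian 1 (θ₀ x) (u₀ x) v = 0) →
      ∃ β₁ : ℝ, 0 < β₁ ∧ ∀ β : ℝ, |β| ≤ β₁ → ∀ ε' : ℝ, 0 < ε' → ∃ τ : ℝ, 0 < τ ∧ ∃ N₀ : ℕ, ∀ N : ℕ, N₀ ≤ N →
      ∀ (Q : Measure (Config (N + 1) (Fin 3) T3)) [IsProbabilityMeasure Q],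
        Q = (localGibbsLaw σ a u₀ θ₀ N (Φ N)).tilted (fun z => β * ∑ i : Fin (N + 1),
              (τ * ((N : ℝ) + 1) ^ (-(1 / 3 : ℝ)))⁻¹ *
                ∫ r in (0 : ℝ)..(τ * ((N : ℝ) + 1) ^ (-(1 / 3 : ℝ))), F (((Φ N).flow r z) i)) →
      ∀ (fbar : ℝ → Measure (T3 × V3)) [∀ r, IsProbabilityMeasure (fbar r)],
        (∀ r, fbar r = ((N : ℝ≥0∞) + 1)⁻¹ • ∑ i : Fin (N + 1), Q.map (fun z => ((Φ N).flow r z) i)) →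
        (ENNReal.ofReal (τ * ((N : ℝ) + 1) ^ (-(1 / 3 : ℝ))))⁻¹ *
            ∫⁻ r in Set.Icc (0 : ℝ) (τ * ((N : ℝ) + 1) ^ (-(1 / 3 : ℝ))),
              ∫⁻ x, (⨅ (u : V3) (θ : ℝ) (_ : 0 < θ),
                  klDiv ((fbar r).condKernel x) (gaussMeasure u θ)) ^ (1 / 2 : ℝ) ∂(fbar r).fst ≤
          ENNReal.ofReal ε' *
            (klDiv Q (localGibbsLaw σ a u₀ θ₀ N (Φ N)) / ((N : ℝ≥0∞) + 1) + 1) := by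
  sorry

/-! ## Composition -/

/-- The line closes the crux modulo its two open stubs: the LANDED named assembly
(`KineticCurrentsWindowLDUniformLocalGibbs.stub_localGibbsLedgerAssemblyByName`, p122768) applied to the LANDED one-body
ledger (S2 p120807 ∘ S1 p118180), the LANDED marginal ledger (S3 p121942), the LANDED entropy quasi-invariance (S5 p121248)
fed by the Rényi stub S4 — itself DERIVED from the open transport stub S4'' via the LANDED reduction p123401 — and the open
residual `C⁺` (S6, which supplies `η₀`). This is the only theorem of the file whose conclusion is the crux constant. -/
theorem KineticCurrentsWindowLDUniform_of : KineticCurrentsWindowLDUniform :=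
  Summit.AtomisticToContinuum.HydrodynamicLimit.Theorems.KineticCurrentsWindowLDUniformLocalGibbs.stub_localGibbsLedgerAssemblyByName
    (stub_oneBodyLedger_of_static stub_staticHydroDomination)
    stub_marginalEntropyLedger (stub_entropyQuasiInvariance_of_renyi stub_windowRenyi)
    stub_integratedKineticEntropyBound

end Summit.AtomisticToContinuum.HydrodynamicLimit.Cruxes.KineticCurrentsWindowLDUniform.LocalGibbsEntropyLedger
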